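import Summits.BirchSwinnertonDyer.BirchSwinnertonDyer.Theorems.ManinLocalTwoThreeEtaMonomialsFortyFive
import Summits.BirchSwinnertonDyer.BirchSwinnertonDyer.Theorems.ManinLocalTwoThreeEtaBasisFortyFiveB
import HarnessLib

/-!
# Level 45: the `q`-limit (I2a)₄₅ `((2πi)⁻¹T′ + φ₄₅·(2S − 3T))/q⁶ → 0` at `i∞`

Cell bsd-f2-manin, route `ManinLocalTwoThree` (crux C3 `ManinPrimeToThreeAtNine`, stmt-22968: `3² ∣ 45`), prover seat p2 gen 28.  With
`T = E₁E₅/(q²E₉E₄₅)`, `S = E₃²E₁₅²/(q³E₉²E₄₅²)` (`…EtaMonomialsFortyFive`) and `φ₄₅ = −3B1 + 3B2 − 3B3 − 8B4 − 2B5 + B7 − B8 + B9 + 2B10` (the pinned newform,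
`…NewformPinningFortyFive.f_apply_eq_fortyFive`; `Bk = q^{a_k}·∏E_δ^{r_δ}` from `…EtaBasisFortyFiveA/B`), the quantity `R = (2πi)⁻¹T′ + φ₄₅(2S − 3T)` is
`N/(q⁹(E₉E₄₅)²)` with `N = q(θE₁·E₅E₉E₄₅ + E₁θE₅·E₉E₄₅ − 2E₁E₅E₉E₄₅ − E₁E₅(θE₉·E₄₅ + E₉θE₄₅)) + φ̃·(2E₃²E₁₅² − 3qE₁E₅E₉E₄₅)` (`θ = (2πi)⁻¹d/dτ`,
`φ̃ = φ₄₅` written in Euler functions); this file proves `N = o(q⁹)` by the `QRemainder` calculus (sub-lemmas, each reduced modulo `X¹⁰`), hence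
**`R/q⁶ → 0`** (`tendsto_I2a`) — what the cusp-form argument of the sequel turns into (I2a)₄₅ `T′ = −2πiφ₄₅(2S − 3T)` via the Sturm bound `6` of `S₂(Γ₀(45))`.
§0: `(2πi)⁻¹E₉′ mod o(q⁹)`.  No definition, no named fact, no sorry; nothing here proves C3, Manin's conjecture or BSD. [cite: Ligozat1975, Ch. 4]
-/

set_option autoImplicit false
-- lint-debt: the directory name repeats the summit name (sibling precedent `ManinLocalTwoThreeEtaLimitDerivFiftySix.lean`)
set_option linter.dupNamespace false

noncomputable section

open Complex Filter Topology Set Asymptotics Polynomial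
open UpperHalfPlane hiding I
open scoped Real Topology Manifold MatrixGroups
open Literature.NumberTheory.EllipticCurves Literature.NumberTheory.EllipticCurves.ModularForms

namespace Summit.BirchSwinnertonDyer.BirchSwinnertonDyer.Theorems.ManinLocalTwoThree.EtaLimitDerivFortyFive

open QRemainder EulerRemainders EulerRemaindersTwenty LevelFortyFour LevelFortyFive EtaMonomialsFortyFive

/-! ## §0 `E₉′` modulo `o(q⁹)` -/

/-- **`E₉′ = 2πi(-9 * q ^ 9) + o(q⁹)`.** [folklore] -/
theorem tendsto_deriv_eulerFn_nine_nine :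
    Tendsto (fun τ : ℍ ↦ (deriv (eulerFn 9 ∘ ofComplex) τ
      - (C (2 * π * I) * (-9 * X ^ 9) : ℂ[X]).eval (Function.Periodic.qParam 1 (τ : ℂ)))
      / Function.Periodic.qParam 1 (τ : ℂ) ^ 9) atImInfty (𝓝 0) := by
  refine congr_poly ?_ (congr_fun (fun τ ↦ deriv_eulerFn_sub_one 9 τ)
    (tendsto_deriv_of_isCuspFunction (isCuspFunction_eulerFn_sub_one (by norm_num : 0 < 9)) 9))
  have h : ∀ n : ℕ, n ≤ 9 → (PowerSeries.coeff n (formalEulerScaled 9) : ℤ) = ([1, 0, 0, 0, 0, 0, 0, 0, 0, -1] : List ℤ).getD n 0 := by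
    intro n hn
    rw [coeff_formalEulerScaled_eq_of_le (by omega)]
    interval_cases n <;> decide
  have hc : ∀ n : ℕ, n ≠ 0 → n ≤ 9 → (qExpansion 1 (eulerFn 9 - 1)).coeff n = ((([1, 0, 0, 0, 0, 0, 0, 0, 0, -1] : List ℤ).getD n 0 : ℤ) : ℂ) :=
    fun n hn hnM ↦ by rw [qExpansion_eulerFn_sub_one_coeff_of_ne_zero (by norm_num) hn, h n hnM]
  simp only [Finset.sum_range_succ, Finset.sum_range_zero, hc 1 (by norm_num) (by norm_num),
    hc 2 (by norm_num) (by norm_num),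
    hc 3 (by norm_num) (by norm_num),
    hc 4 (by norm_num) (by norm_num),
    hc 5 (by norm_num) (by norm_num),
    hc 6 (by norm_num) (by norm_num),
    hc 7 (by norm_num) (by norm_num),
    hc 8 (by norm_num) (by norm_num),
    hc 9 (by norm_num) (by norm_num)]
  norm_num
  simp only [map_ofNat]
  ring

set_option maxHeartbeats 800000 in -- staged `QRemainder` products at precision 9
/-- **The derivative part** `q(θE₁E₅E₉E₄₅ + E₁θE₅E₉E₄₅ − 2E₁E₅E₉E₄₅ − E₁E₅θE₉E₄₅ − E₁E₅E₉θE₄₅)` `= -2 * q + q ^ 2 + 4 * q ^ 7 + 10 * q ^ 8 + o(q⁹)`. [folklore] -/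
theorem tendsto_termA :
    Tendsto (fun τ : ℍ ↦ ((Function.Periodic.qParam 1 (τ : ℂ) ^ 1 * (((2 * π * I)⁻¹ * deriv (eulerFn 1 ∘ ofComplex) τ) * eulerFn 5 τ * eulerFn 9 τ * eulerFn 45 τ + eulerFn 1 τ * ((2 * π * I)⁻¹ * deriv (eulerFn 5 ∘ ofComplex) τ) * eulerFn 9 τ * eulerFn 45 τ - 2 * (eulerFn 1 τ * eulerFn 5 τ * eulerFn 9 τ * eulerFn 45 τ) - eulerFn 1 τ * eulerFn 5 τ * ((2 * π * I)⁻¹ * deriv (eulerFn 9 ∘ ofComplex) τ) * eulerFn 45 τ - eulerFn 1 τ * eulerFn 5 τ * eulerFn 9 τ * ((2 * π * I)⁻¹ * deriv (eulerFn 45 ∘ ofComplex) τ)))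
      - (-2 * X + X ^ 2 + 4 * X ^ 7 + 10 * X ^ 8 : ℂ[X]).eval (Function.Periodic.qParam 1 (τ : ℂ)))
      / Function.Periodic.qParam 1 (τ : ℂ) ^ 9) atImInfty (𝓝 0) := by
  have h2pi : (2 * π * I : ℂ) ≠ 0 := by simp [Real.pi_ne_zero, I_ne_zero]
  have h1 := QRemainder.congr_poly (P' := -X - 2 * X ^ 2 + 5 * X ^ 5 + 7 * X ^ 7)
    (by rw [← mul_assoc, ← map_mul, inv_mul_cancel₀ h2pi, map_one, one_mul])
    (QRemainder.const_mul (2 * π * I)⁻¹ EtaMonomialsFortyFive.tendsto_deriv_eulerFn_one_nine)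
  have h2 := EulerRemaindersTwenty.tendsto_mono (show 9 ≤ 33 by norm_num) LevelFortyFive.tendsto_eulerFn_five_thirtyThree
  have h3 := EulerRemaindersTwenty.tendsto_mono (show 9 ≤ 33 by norm_num) LevelFortyFive.tendsto_eulerFn_nine_thirtyThree
  have h4 := tendsto_eulerFn (δ := 45) (m := 9) (by norm_num)
  have h5 := QRemainder.reduce (-X - 2 * X ^ 2 + 5 * X ^ 5 + X ^ 6 + 9 * X ^ 7) (-5 + X - 5 * X ^ 2 - 5 * X ^ 5 - 7 * X ^ 7 - X ^ 16 - 2 * X ^ 17 + 5 * X ^ 20 + 7 * X ^ 22 : ℂ[X]) (by ring) (QRemainder.mul h1 h2)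
  have h6 := QRemainder.reduce (-X - 2 * X ^ 2 + 5 * X ^ 5 + X ^ 6 + 9 * X ^ 7) (1 + 2 * X - 5 * X ^ 4 - X ^ 5 - 9 * X ^ 6 + X ^ 9 + 2 * X ^ 10 - 5 * X ^ 13 - X ^ 14 - 9 * X ^ 15 : ℂ[X]) (by ring) (QRemainder.mul h5 h3)
  have h7 := QRemainder.mul h6 h4
  have h8 := EulerRemaindersTwenty.tendsto_mono (show 9 ≤ 33 by norm_num) LevelFortyFour.tendsto_eulerFn_one_thirtyThree
  have h9 := QRemainder.congr_poly (P' := -5 * X ^ 5)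
    (by rw [← mul_assoc, ← map_mul, inv_mul_cancel₀ h2pi, map_one, one_mul])
    (QRemainder.const_mul (2 * π * I)⁻¹ EtaMonomialsFortyFive.tendsto_deriv_eulerFn_five_nine)
  have h10 := EulerRemaindersTwenty.tendsto_mono (show 9 ≤ 33 by norm_num) LevelFortyFive.tendsto_eulerFn_nine_thirtyThree
  have h11 := tendsto_eulerFn (δ := 45) (m := 9) (by norm_num)
  have h12 := QRemainder.reduce (-5 * X ^ 5 + 5 * X ^ 6 + 5 * X ^ 7) (-5 - 5 * X ^ 2 + 5 * X ^ 7 + 5 * X ^ 10 - 5 * X ^ 17 - 5 * X ^ 21 : ℂ[X]) (by ring) (QRemainder.mul h8 h9)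
  have h13 := QRemainder.reduce (-5 * X ^ 5 + 5 * X ^ 6 + 5 * X ^ 7) (5 * X ^ 4 - 5 * X ^ 5 - 5 * X ^ 6 + 5 * X ^ 13 - 5 * X ^ 14 - 5 * X ^ 15 : ℂ[X]) (by ring) (QRemainder.mul h12 h10)
  have h14 := QRemainder.mul h13 h11
  have h15 := EulerRemaindersTwenty.tendsto_mono (show 9 ≤ 33 by norm_num) LevelFortyFour.tendsto_eulerFn_one_thirtyThree
  have h16 := EulerRemaindersTwenty.tendsto_mono (show 9 ≤ 33 by norm_num) LevelFortyFive.tendsto_eulerFn_five_thirtyThree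
  have h17 := EulerRemaindersTwenty.tendsto_mono (show 9 ≤ 33 by norm_num) LevelFortyFive.tendsto_eulerFn_nine_thirtyThree
  have h18 := tendsto_eulerFn (δ := 45) (m := 9) (by norm_num)
  have h19 := QRemainder.reduce (1 - X - X ^ 2 + X ^ 6 + 2 * X ^ 7) (-2 + X - X ^ 2 - 2 * X ^ 5 + X ^ 10 + 2 * X ^ 12 + 2 * X ^ 15 - 2 * X ^ 17 + X ^ 20 - X ^ 21 - X ^ 26 - X ^ 27 - X ^ 30 + X ^ 37 + X ^ 41 : ℂ[X]) (by ring) (QRemainder.mul h15 h16)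
  have h20 := QRemainder.reduce (1 - X - X ^ 2 + X ^ 6 + 2 * X ^ 7 - X ^ 9) (1 + X - X ^ 5 - 2 * X ^ 6 - X ^ 8 + X ^ 9 + X ^ 10 - X ^ 14 - 2 * X ^ 15 : ℂ[X]) (by ring) (QRemainder.mul h19 h17)
  have h21 := QRemainder.mul h20 h18
  have h22 := QRemainder.reduce (2 - 2 * X - 2 * X ^ 2 + 2 * X ^ 6 + 4 * X ^ 7 - 2 * X ^ 9) (0 : ℂ[X]) (by simp only [map_ofNat]; ring) (QRemainder.const_mul (2 : ℂ) h21)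
  have h23 := EulerRemaindersTwenty.tendsto_mono (show 9 ≤ 33 by norm_num) LevelFortyFour.tendsto_eulerFn_one_thirtyThree
  have h24 := EulerRemaindersTwenty.tendsto_mono (show 9 ≤ 33 by norm_num) LevelFortyFive.tendsto_eulerFn_five_thirtyThree
  have h25 := QRemainder.congr_poly (P' := -9 * X ^ 9)
    (by rw [← mul_assoc, ← map_mul, inv_mul_cancel₀ h2pi, map_one, one_mul])
    (QRemainder.const_mul (2 * π * I)⁻¹ tendsto_deriv_eulerFn_nine_nine)
  have h26 := tendsto_eulerFn (δ := 45) (m := 9) (by norm_num)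
  have h27 := QRemainder.reduce (1 - X - X ^ 2 + X ^ 6 + 2 * X ^ 7) (-2 + X - X ^ 2 - 2 * X ^ 5 + X ^ 10 + 2 * X ^ 12 + 2 * X ^ 15 - 2 * X ^ 17 + X ^ 20 - X ^ 21 - X ^ 26 - X ^ 27 - X ^ 30 + X ^ 37 + X ^ 41 : ℂ[X]) (by ring) (QRemainder.mul h23 h24)
  have h28 := QRemainder.reduce (-9 * X ^ 9) (9 + 9 * X - 9 * X ^ 5 - 18 * X ^ 6 : ℂ[X]) (by ring) (QRemainder.mul h27 h25)
  have h29 := QRemainder.mul h28 h26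
  have h30 := EulerRemaindersTwenty.tendsto_mono (show 9 ≤ 33 by norm_num) LevelFortyFour.tendsto_eulerFn_one_thirtyThree
  have h31 := EulerRemaindersTwenty.tendsto_mono (show 9 ≤ 33 by norm_num) LevelFortyFive.tendsto_eulerFn_five_thirtyThree
  have h32 := EulerRemaindersTwenty.tendsto_mono (show 9 ≤ 33 by norm_num) LevelFortyFive.tendsto_eulerFn_nine_thirtyThree
  have h33 := QRemainder.congr_poly (P' := 0) (by rw [mul_zero])
    (QRemainder.const_mul (2 * π * I)⁻¹ (tendsto_deriv_eulerFn (δ := 45) (m := 9) (by norm_num)))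
  have h34 := QRemainder.reduce (1 - X - X ^ 2 + X ^ 6 + 2 * X ^ 7) (-2 + X - X ^ 2 - 2 * X ^ 5 + X ^ 10 + 2 * X ^ 12 + 2 * X ^ 15 - 2 * X ^ 17 + X ^ 20 - X ^ 21 - X ^ 26 - X ^ 27 - X ^ 30 + X ^ 37 + X ^ 41 : ℂ[X]) (by ring) (QRemainder.mul h30 h31)
  have h35 := QRemainder.reduce (1 - X - X ^ 2 + X ^ 6 + 2 * X ^ 7 - X ^ 9) (1 + X - X ^ 5 - 2 * X ^ 6 - X ^ 8 + X ^ 9 + X ^ 10 - X ^ 14 - 2 * X ^ 15 : ℂ[X]) (by ring) (QRemainder.mul h34 h32)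
  have h36 := QRemainder.mul h35 h33
  have h37 := QRemainder.add h7 h14
  have h38 := QRemainder.sub h37 h22
  have h39 := QRemainder.sub h38 h29
  have h40 := QRemainder.sub h39 h36
  have h41 := QRemainder.reduce (-2 * X + X ^ 2 + 4 * X ^ 7 + 10 * X ^ 8) (11 : ℂ[X]) (by ring) (QRemainder.qParam_pow_mul 1 h40)
  have hfin := QRemainder.congr_poly (P' := (-2 * X + X ^ 2 + 4 * X ^ 7 + 10 * X ^ 8 : ℂ[X])) (by ring) h41
  exact QRemainder.congr_fun (fun τ ↦ by ring) hfin

set_option maxHeartbeats 800000 in -- staged `QRemainder` products at precision 9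
/-- **`φ₄₅` in Euler functions, first half** (`B1, B2, B3, B4` terms) `= -3 * q ^ 2 - 8 * q ^ 4 - 6 * q ^ 5 + 3 * q ^ 6 - 8 * q ^ 7 - 15 * q ^ 8 + 3 * q ^ 9 + o(q⁹)`. [folklore] -/
theorem tendsto_phiA :
    Tendsto (fun τ : ℍ ↦ ((3 * (Function.Periodic.qParam 1 (τ : ℂ) ^ 6 * ((eulerFn 3 τ)⁻¹ * eulerFn 9 τ ^ 3 * (eulerFn 15 τ)⁻¹ * eulerFn 45 τ ^ 3)) - 3 * (Function.Periodic.qParam 1 (τ : ℂ) ^ 10 * ((eulerFn 15 τ ^ 2)⁻¹ * eulerFn 45 τ ^ 6)) - 3 * (Function.Periodic.qParam 1 (τ : ℂ) ^ 2 * ((eulerFn 3 τ ^ 2)⁻¹ * eulerFn 9 τ ^ 6)) - 8 * (Function.Periodic.qParam 1 (τ : ℂ) ^ 4 * ((eulerFn 3 τ)⁻¹ * eulerFn 9 τ * eulerFn 15 τ ^ 3 * eulerFn 45 τ)))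
      - (-3 * X ^ 2 - 8 * X ^ 4 - 6 * X ^ 5 + 3 * X ^ 6 - 8 * X ^ 7 - 15 * X ^ 8 + 3 * X ^ 9 : ℂ[X]).eval (Function.Periodic.qParam 1 (τ : ℂ)))
      / Function.Periodic.qParam 1 (τ : ℂ) ^ 9) atImInfty (𝓝 0) := by
  have h1 := EulerRemaindersTwenty.tendsto_mono (show 9 ≤ 33 by norm_num) LevelFortyFive.tendsto_eulerFn_three_thirtyThree
  have h2 := QRemainder.inv (1 + X ^ 3 + 2 * X ^ 6 + 3 * X ^ 9) (-5 * X ^ 2 - 2 * X ^ 5 + X ^ 8 + 3 * X ^ 11 + 4 * X ^ 14 + 2 * X ^ 17 + 3 * X ^ 20 : ℂ[X]) (by ring)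
    (fun τ ↦ eulerFn_ne_zero (by norm_num) τ) (by simp) h1
  have h3 := EulerRemaindersTwenty.tendsto_mono (show 9 ≤ 33 by norm_num) LevelFortyFive.tendsto_eulerFn_nine_thirtyThree
  have h4 := QRemainder.reduce (1 - 3 * X ^ 9) (5 * X ^ 17 - 3 * X ^ 35 - X ^ 44 : ℂ[X]) (by ring) (QRemainder.pow h3 3)
  have h5 := QRemainder.reduce (1 + X ^ 3 + 2 * X ^ 6) (-3 * X ^ 2 - 6 * X ^ 5 - 9 * X ^ 8 : ℂ[X]) (by ring) (QRemainder.mul h2 h4)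
  have h6 := tendsto_eulerFn (δ := 15) (m := 9) (by norm_num)
  have h7 := QRemainder.inv (1) (0 : ℂ[X]) (by ring)
    (fun τ ↦ eulerFn_ne_zero (by norm_num) τ) (by simp) h6
  have h8 := QRemainder.mul h5 h7
  have h9 := tendsto_eulerFn (δ := 45) (m := 9) (by norm_num)
  have h10 := QRemainder.pow h9 3
  have h11 := QRemainder.mul h8 h10
  have h12 := QRemainder.reduce (X ^ 6 + X ^ 9) (2 * X ^ 2 : ℂ[X]) (by ring) (QRemainder.qParam_pow_mul 6 h11)
  have h13 := QRemainder.reduce (3 * X ^ 6 + 3 * X ^ 9) (0 : ℂ[X]) (by simp only [map_ofNat]; ring) (QRemainder.const_mul (3 : ℂ) h12)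
  have h14 := tendsto_eulerFn (δ := 15) (m := 9) (by norm_num)
  have h15 := QRemainder.pow h14 2
  have h16 := QRemainder.inv (1) (0 : ℂ[X]) (by ring)
    (fun τ ↦ pow_ne_zero _ (eulerFn_ne_zero (by norm_num) τ)) (by simp) h15
  have h17 := tendsto_eulerFn (δ := 45) (m := 9) (by norm_num)
  have h18 := QRemainder.pow h17 6
  have h19 := QRemainder.mul h16 h18
  have h20 := QRemainder.reduce (0) (1 : ℂ[X]) (by ring) (QRemainder.qParam_pow_mul 10 h19)
  have h21 := QRemainder.reduce (0) (0 : ℂ[X]) (by simp only [map_ofNat]; ring) (QRemainder.const_mul (3 : ℂ) h20)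
  have h22 := QRemainder.sub h13 h21
  have h23 := EulerRemaindersTwenty.tendsto_mono (show 9 ≤ 33 by norm_num) LevelFortyFive.tendsto_eulerFn_three_thirtyThree
  have h24 := QRemainder.reduce (1 - 2 * X ^ 3 - X ^ 6 + 2 * X ^ 9) (X ^ 2 + 2 * X ^ 5 - 2 * X ^ 8 - 2 * X ^ 14 - 2 * X ^ 17 + X ^ 20 + 2 * X ^ 26 + X ^ 32 : ℂ[X]) (by ring) (QRemainder.pow h23 2)
  have h25 := QRemainder.inv (1 + 2 * X ^ 3 + 5 * X ^ 6 + 10 * X ^ 9) (-21 * X ^ 2 + 20 * X ^ 8 : ℂ[X]) (by ring)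
    (fun τ ↦ pow_ne_zero _ (eulerFn_ne_zero (by norm_num) τ)) (by simp) h24
  have h26 := EulerRemaindersTwenty.tendsto_mono (show 9 ≤ 33 by norm_num) LevelFortyFive.tendsto_eulerFn_nine_thirtyThree
  have h27 := QRemainder.reduce (1 - 6 * X ^ 9) (9 * X ^ 8 + 10 * X ^ 17 - 30 * X ^ 26 - 6 * X ^ 35 + 41 * X ^ 44 + 6 * X ^ 53 - 30 * X ^ 62 - 10 * X ^ 71 + 9 * X ^ 80 + 6 * X ^ 89 + X ^ 98 : ℂ[X]) (by ring) (QRemainder.pow h26 6)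
  have h28 := QRemainder.reduce (1 + 2 * X ^ 3 + 5 * X ^ 6 + 4 * X ^ 9) (-12 * X ^ 2 - 30 * X ^ 5 - 60 * X ^ 8 : ℂ[X]) (by ring) (QRemainder.mul h25 h27)
  have h29 := QRemainder.reduce (X ^ 2 + 2 * X ^ 5 + 5 * X ^ 8) (4 * X : ℂ[X]) (by ring) (QRemainder.qParam_pow_mul 2 h28)
  have h30 := QRemainder.reduce (3 * X ^ 2 + 6 * X ^ 5 + 15 * X ^ 8) (0 : ℂ[X]) (by simp only [map_ofNat]; ring) (QRemainder.const_mul (3 : ℂ) h29)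
  have h31 := QRemainder.sub h22 h30
  have h32 := EulerRemaindersTwenty.tendsto_mono (show 9 ≤ 33 by norm_num) LevelFortyFive.tendsto_eulerFn_three_thirtyThree
  have h33 := QRemainder.inv (1 + X ^ 3 + 2 * X ^ 6 + 3 * X ^ 9) (-5 * X ^ 2 - 2 * X ^ 5 + X ^ 8 + 3 * X ^ 11 + 4 * X ^ 14 + 2 * X ^ 17 + 3 * X ^ 20 : ℂ[X]) (by ring)
    (fun τ ↦ eulerFn_ne_zero (by norm_num) τ) (by simp) h32
  have h34 := EulerRemaindersTwenty.tendsto_mono (show 9 ≤ 33 by norm_num) LevelFortyFive.tendsto_eulerFn_nine_thirtyThree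
  have h35 := QRemainder.reduce (1 + X ^ 3 + 2 * X ^ 6 + 2 * X ^ 9) (-X ^ 2 - 2 * X ^ 5 - 4 * X ^ 8 - X ^ 11 - 2 * X ^ 14 - 3 * X ^ 17 : ℂ[X]) (by ring) (QRemainder.mul h33 h34)
  have h36 := tendsto_eulerFn (δ := 15) (m := 9) (by norm_num)
  have h37 := QRemainder.pow h36 3
  have h38 := QRemainder.mul h35 h37
  have h39 := tendsto_eulerFn (δ := 45) (m := 9) (by norm_num)
  have h40 := QRemainder.mul h38 h39
  have h41 := QRemainder.reduce (X ^ 4 + X ^ 7) (2 + 2 * X ^ 3 : ℂ[X]) (by ring) (QRemainder.qParam_pow_mul 4 h40)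
  have h42 := QRemainder.reduce (8 * X ^ 4 + 8 * X ^ 7) (0 : ℂ[X]) (by simp only [map_ofNat]; ring) (QRemainder.const_mul (8 : ℂ) h41)
  have h43 := QRemainder.sub h31 h42
  have hfin := QRemainder.congr_poly (P' := (-3 * X ^ 2 - 8 * X ^ 4 - 6 * X ^ 5 + 3 * X ^ 6 - 8 * X ^ 7 - 15 * X ^ 8 + 3 * X ^ 9 : ℂ[X])) (by ring) h43
  exact QRemainder.congr_fun (fun τ ↦ by ring) hfin

set_option maxHeartbeats 800000 in -- staged `QRemainder` products at precision 9
/-- **`φ₄₅` in Euler functions, second half** (`B5, B7, B8, B9, B10` terms) `= q + 4 * q ^ 2 + 7 * q ^ 4 + 5 * q ^ 5 - 3 * q ^ 6 + 8 * q ^ 7 + 12 * q ^ 8 - 3 * q ^ 9 + o(q⁹)`. [folklore] -/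
theorem tendsto_phiB :
    Tendsto (fun τ : ℍ ↦ (((((eulerFn 5 τ ^ 3)⁻¹ * eulerFn 15 τ ^ 10 * (eulerFn 45 τ ^ 3)⁻¹)) - 2 * (((eulerFn 3 τ ^ 2)⁻¹ * eulerFn 9 τ ^ 4 * eulerFn 15 τ ^ 4 * (eulerFn 45 τ ^ 2)⁻¹)) - (Function.Periodic.qParam 1 (τ : ℂ) ^ 4 * ((eulerFn 1 τ)⁻¹ * eulerFn 3 τ ^ 2 * eulerFn 5 τ ^ 2 * (eulerFn 9 τ)⁻¹ * eulerFn 45 τ ^ 2)) + (((eulerFn 1 τ)⁻¹ * eulerFn 3 τ * eulerFn 5 τ ^ 2 * eulerFn 9 τ ^ 2 * eulerFn 15 τ * (eulerFn 45 τ)⁻¹)) + 2 * (Function.Periodic.qParam 1 (τ : ℂ) ^ 2 * ((eulerFn 1 τ)⁻¹ * eulerFn 3 τ ^ 3 * (eulerFn 5 τ)⁻¹ * eulerFn 15 τ ^ 3)))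
      - (X + 4 * X ^ 2 + 7 * X ^ 4 + 5 * X ^ 5 - 3 * X ^ 6 + 8 * X ^ 7 + 12 * X ^ 8 - 3 * X ^ 9 : ℂ[X]).eval (Function.Periodic.qParam 1 (τ : ℂ)))
      / Function.Periodic.qParam 1 (τ : ℂ) ^ 9) atImInfty (𝓝 0) := by
  have h1 := EulerRemaindersTwenty.tendsto_mono (show 9 ≤ 33 by norm_num) LevelFortyFive.tendsto_eulerFn_five_thirtyThree
  have h2 := QRemainder.reduce (1 - 3 * X ^ 5) (5 * X ^ 5 - 7 * X ^ 20 - 3 * X ^ 25 + 6 * X ^ 30 + 3 * X ^ 35 + 3 * X ^ 40 - 3 * X ^ 45 - 3 * X ^ 50 + X ^ 65 : ℂ[X]) (by ring) (QRemainder.pow h1 3)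
  have h3 := QRemainder.inv (1 + 3 * X ^ 5) (-9 : ℂ[X]) (by ring)
    (fun τ ↦ pow_ne_zero _ (eulerFn_ne_zero (by norm_num) τ)) (by simp) h2
  have h4 := tendsto_eulerFn (δ := 15) (m := 9) (by norm_num)
  have h5 := QRemainder.pow h4 10
  have h6 := QRemainder.mul h3 h5
  have h7 := tendsto_eulerFn (δ := 45) (m := 9) (by norm_num)
  have h8 := QRemainder.pow h7 3
  have h9 := QRemainder.inv (1) (0 : ℂ[X]) (by ring)
    (fun τ ↦ pow_ne_zero _ (eulerFn_ne_zero (by norm_num) τ)) (by simp) h8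
  have h10 := QRemainder.mul h6 h9
  have h11 := EulerRemaindersTwenty.tendsto_mono (show 9 ≤ 33 by norm_num) LevelFortyFive.tendsto_eulerFn_three_thirtyThree
  have h12 := QRemainder.reduce (1 - 2 * X ^ 3 - X ^ 6 + 2 * X ^ 9) (X ^ 2 + 2 * X ^ 5 - 2 * X ^ 8 - 2 * X ^ 14 - 2 * X ^ 17 + X ^ 20 + 2 * X ^ 26 + X ^ 32 : ℂ[X]) (by ring) (QRemainder.pow h11 2)
  have h13 := QRemainder.inv (1 + 2 * X ^ 3 + 5 * X ^ 6 + 10 * X ^ 9) (-21 * X ^ 2 + 20 * X ^ 8 : ℂ[X]) (by ring)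
    (fun τ ↦ pow_ne_zero _ (eulerFn_ne_zero (by norm_num) τ)) (by simp) h12
  have h14 := EulerRemaindersTwenty.tendsto_mono (show 9 ≤ 33 by norm_num) LevelFortyFive.tendsto_eulerFn_nine_thirtyThree
  have h15 := QRemainder.reduce (1 - 4 * X ^ 9) (2 * X ^ 8 + 8 * X ^ 17 - 5 * X ^ 26 - 8 * X ^ 35 + 2 * X ^ 44 + 4 * X ^ 53 + X ^ 62 : ℂ[X]) (by ring) (QRemainder.pow h14 4)
  have h16 := QRemainder.reduce (1 + 2 * X ^ 3 + 5 * X ^ 6 + 6 * X ^ 9) (-8 * X ^ 2 - 20 * X ^ 5 - 40 * X ^ 8 : ℂ[X]) (by ring) (QRemainder.mul h13 h15)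
  have h17 := tendsto_eulerFn (δ := 15) (m := 9) (by norm_num)
  have h18 := QRemainder.pow h17 4
  have h19 := QRemainder.mul h16 h18
  have h20 := tendsto_eulerFn (δ := 45) (m := 9) (by norm_num)
  have h21 := QRemainder.pow h20 2
  have h22 := QRemainder.inv (1) (0 : ℂ[X]) (by ring)
    (fun τ ↦ pow_ne_zero _ (eulerFn_ne_zero (by norm_num) τ)) (by simp) h21
  have h23 := QRemainder.mul h19 h22
  have h24 := QRemainder.reduce (2 + 4 * X ^ 3 + 10 * X ^ 6 + 12 * X ^ 9) (0 : ℂ[X]) (by simp only [map_ofNat]; ring) (QRemainder.const_mul (2 : ℂ) h23)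
  have h25 := QRemainder.sub h10 h24
  have h26 := EulerRemaindersTwenty.tendsto_mono (show 9 ≤ 33 by norm_num) LevelFortyFour.tendsto_eulerFn_one_thirtyThree
  have h27 := QRemainder.inv (1 + X + 2 * X ^ 2 + 3 * X ^ 3 + 5 * X ^ 4 + 7 * X ^ 5 + 11 * X ^ 6 + 15 * X ^ 7 + 22 * X ^ 8 + 30 * X ^ 9) (-42 - 14 * X + 21 * X ^ 2 + 32 * X ^ 3 + 43 * X ^ 4 + 18 * X ^ 5 + 24 * X ^ 6 - 9 * X ^ 7 - 14 * X ^ 8 - 20 * X ^ 9 - 29 * X ^ 10 - 41 * X ^ 11 - 14 * X ^ 12 - 21 * X ^ 13 - 28 * X ^ 14 + 3 * X ^ 15 + 6 * X ^ 16 + 8 * X ^ 17 + 13 * X ^ 18 + 18 * X ^ 19 + 27 * X ^ 20 + 37 * X ^ 21 + 11 * X ^ 22 + 15 * X ^ 23 + 22 * X ^ 24 + 30 * X ^ 25 : ℂ[X]) (by ring)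
    (fun τ ↦ eulerFn_ne_zero (by norm_num) τ) (by simp) h26
  have h28 := EulerRemaindersTwenty.tendsto_mono (show 9 ≤ 33 by norm_num) LevelFortyFive.tendsto_eulerFn_three_thirtyThree
  have h29 := QRemainder.reduce (1 - 2 * X ^ 3 - X ^ 6 + 2 * X ^ 9) (X ^ 2 + 2 * X ^ 5 - 2 * X ^ 8 - 2 * X ^ 14 - 2 * X ^ 17 + X ^ 20 + 2 * X ^ 26 + X ^ 32 : ℂ[X]) (by ring) (QRemainder.pow h28 2)
  have h30 := QRemainder.reduce (1 + X + 2 * X ^ 2 + X ^ 3 + 3 * X ^ 4 + 3 * X ^ 5 + 4 * X ^ 6 + 4 * X ^ 7 + 6 * X ^ 8 + 7 * X ^ 9) (-33 - 47 * X - 65 * X ^ 2 - 5 * X ^ 3 - 8 * X ^ 4 - 8 * X ^ 5 + 30 * X ^ 6 + 44 * X ^ 7 + 60 * X ^ 8 : ℂ[X]) (by ring) (QRemainder.mul h27 h29)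
  have h31 := EulerRemaindersTwenty.tendsto_mono (show 9 ≤ 33 by norm_num) LevelFortyFive.tendsto_eulerFn_five_thirtyThree
  have h32 := QRemainder.reduce (1 - 2 * X ^ 5) (-1 + 2 * X ^ 5 + X ^ 10 + 2 * X ^ 15 - 2 * X ^ 20 - 2 * X ^ 25 + X ^ 40 : ℂ[X]) (by ring) (QRemainder.pow h31 2)
  have h33 := QRemainder.reduce (1 + X + 2 * X ^ 2 + X ^ 3 + 3 * X ^ 4 + X ^ 5 + 2 * X ^ 6 + 4 * X ^ 8 + X ^ 9) (-6 - 8 * X - 8 * X ^ 2 - 12 * X ^ 3 - 14 * X ^ 4 : ℂ[X]) (by ring) (QRemainder.mul h30 h32)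
  have h34 := EulerRemaindersTwenty.tendsto_mono (show 9 ≤ 33 by norm_num) LevelFortyFive.tendsto_eulerFn_nine_thirtyThree
  have h35 := QRemainder.inv (1 + X ^ 9) (-2 * X ^ 8 - X ^ 17 : ℂ[X]) (by ring)
    (fun τ ↦ eulerFn_ne_zero (by norm_num) τ) (by simp) h34
  have h36 := QRemainder.reduce (1 + X + 2 * X ^ 2 + X ^ 3 + 3 * X ^ 4 + X ^ 5 + 2 * X ^ 6 + 4 * X ^ 8 + 2 * X ^ 9) (1 + 2 * X + X ^ 2 + 3 * X ^ 3 + X ^ 4 + 2 * X ^ 5 + 4 * X ^ 7 + X ^ 8 : ℂ[X]) (by ring) (QRemainder.mul h33 h35)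
  have h37 := tendsto_eulerFn (δ := 45) (m := 9) (by norm_num)
  have h38 := QRemainder.pow h37 2
  have h39 := QRemainder.mul h36 h38
  have h40 := QRemainder.reduce (X ^ 4 + X ^ 5 + 2 * X ^ 6 + X ^ 7 + 3 * X ^ 8 + X ^ 9) (2 + 4 * X ^ 2 + 2 * X ^ 3 : ℂ[X]) (by ring) (QRemainder.qParam_pow_mul 4 h39)
  have h41 := QRemainder.sub h25 h40
  have h42 := EulerRemaindersTwenty.tendsto_mono (show 9 ≤ 33 by norm_num) LevelFortyFour.tendsto_eulerFn_one_thirtyThree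
  have h43 := QRemainder.inv (1 + X + 2 * X ^ 2 + 3 * X ^ 3 + 5 * X ^ 4 + 7 * X ^ 5 + 11 * X ^ 6 + 15 * X ^ 7 + 22 * X ^ 8 + 30 * X ^ 9) (-42 - 14 * X + 21 * X ^ 2 + 32 * X ^ 3 + 43 * X ^ 4 + 18 * X ^ 5 + 24 * X ^ 6 - 9 * X ^ 7 - 14 * X ^ 8 - 20 * X ^ 9 - 29 * X ^ 10 - 41 * X ^ 11 - 14 * X ^ 12 - 21 * X ^ 13 - 28 * X ^ 14 + 3 * X ^ 15 + 6 * X ^ 16 + 8 * X ^ 17 + 13 * X ^ 18 + 18 * X ^ 19 + 27 * X ^ 20 + 37 * X ^ 21 + 11 * X ^ 22 + 15 * X ^ 23 + 22 * X ^ 24 + 30 * X ^ 25 : ℂ[X]) (by ring)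
    (fun τ ↦ eulerFn_ne_zero (by norm_num) τ) (by simp) h42
  have h44 := EulerRemaindersTwenty.tendsto_mono (show 9 ≤ 33 by norm_num) LevelFortyFive.tendsto_eulerFn_three_thirtyThree
  have h45 := QRemainder.reduce (1 + X + 2 * X ^ 2 + 2 * X ^ 3 + 4 * X ^ 4 + 5 * X ^ 5 + 7 * X ^ 6 + 9 * X ^ 7 + 13 * X ^ 8 + 16 * X ^ 9) (-20 - 29 * X - 41 * X ^ 2 - 15 * X ^ 3 - 22 * X ^ 4 - 29 * X ^ 5 + X ^ 6 + 2 * X ^ 7 + 3 * X ^ 8 + 5 * X ^ 9 + 7 * X ^ 10 + 12 * X ^ 11 + 16 * X ^ 12 + 24 * X ^ 13 + 33 * X ^ 14 + 5 * X ^ 15 + 7 * X ^ 16 + 11 * X ^ 17 + 15 * X ^ 18 + 22 * X ^ 19 + 30 * X ^ 20 : ℂ[X]) (by ring) (QRemainder.mul h43 h44)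
  have h46 := EulerRemaindersTwenty.tendsto_mono (show 9 ≤ 33 by norm_num) LevelFortyFive.tendsto_eulerFn_five_thirtyThree
  have h47 := QRemainder.reduce (1 - 2 * X ^ 5) (-1 + 2 * X ^ 5 + X ^ 10 + 2 * X ^ 15 - 2 * X ^ 20 - 2 * X ^ 25 + X ^ 40 : ℂ[X]) (by ring) (QRemainder.pow h46 2)
  have h48 := QRemainder.reduce (1 + X + 2 * X ^ 2 + 2 * X ^ 3 + 4 * X ^ 4 + 3 * X ^ 5 + 5 * X ^ 6 + 5 * X ^ 7 + 9 * X ^ 8 + 8 * X ^ 9) (-10 - 14 * X - 18 * X ^ 2 - 26 * X ^ 3 - 32 * X ^ 4 : ℂ[X]) (by ring) (QRemainder.mul h45 h47)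
  have h49 := EulerRemaindersTwenty.tendsto_mono (show 9 ≤ 33 by norm_num) LevelFortyFive.tendsto_eulerFn_nine_thirtyThree
  have h50 := QRemainder.reduce (1 - 2 * X ^ 9) (-X ^ 8 + 2 * X ^ 17 + X ^ 26 : ℂ[X]) (by ring) (QRemainder.pow h49 2)
  have h51 := QRemainder.reduce (1 + X + 2 * X ^ 2 + 2 * X ^ 3 + 4 * X ^ 4 + 3 * X ^ 5 + 5 * X ^ 6 + 5 * X ^ 7 + 9 * X ^ 8 + 6 * X ^ 9) (-2 - 4 * X - 4 * X ^ 2 - 8 * X ^ 3 - 6 * X ^ 4 - 10 * X ^ 5 - 10 * X ^ 6 - 18 * X ^ 7 - 16 * X ^ 8 : ℂ[X]) (by ring) (QRemainder.mul h48 h50)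
  have h52 := tendsto_eulerFn (δ := 15) (m := 9) (by norm_num)
  have h53 := QRemainder.mul h51 h52
  have h54 := tendsto_eulerFn (δ := 45) (m := 9) (by norm_num)
  have h55 := QRemainder.inv (1) (0 : ℂ[X]) (by ring)
    (fun τ ↦ eulerFn_ne_zero (by norm_num) τ) (by simp) h54
  have h56 := QRemainder.mul h53 h55
  have h57 := QRemainder.add h41 h56
  have h58 := EulerRemaindersTwenty.tendsto_mono (show 9 ≤ 33 by norm_num) LevelFortyFour.tendsto_eulerFn_one_thirtyThree
  have h59 := QRemainder.inv (1 + X + 2 * X ^ 2 + 3 * X ^ 3 + 5 * X ^ 4 + 7 * X ^ 5 + 11 * X ^ 6 + 15 * X ^ 7 + 22 * X ^ 8 + 30 * X ^ 9) (-42 - 14 * X + 21 * X ^ 2 + 32 * X ^ 3 + 43 * X ^ 4 + 18 * X ^ 5 + 24 * X ^ 6 - 9 * X ^ 7 - 14 * X ^ 8 - 20 * X ^ 9 - 29 * X ^ 10 - 41 * X ^ 11 - 14 * X ^ 12 - 21 * X ^ 13 - 28 * X ^ 14 + 3 * X ^ 15 + 6 * X ^ 16 + 8 * X ^ 17 + 13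 * X ^ 18 + 18 * X ^ 19 + 27 * X ^ 20 + 37 * X ^ 21 + 11 * X ^ 22 + 15 * X ^ 23 + 22 * X ^ 24 + 30 * X ^ 25 : ℂ[X]) (by ring)
    (fun τ ↦ eulerFn_ne_zero (by norm_num) τ) (by simp) h58
  have h60 := EulerRemaindersTwenty.tendsto_mono (show 9 ≤ 33 by norm_num) LevelFortyFive.tendsto_eulerFn_three_thirtyThree
  have h61 := QRemainder.reduce (1 - 3 * X ^ 3 + 5 * X ^ 9) (-7 * X ^ 8 + 9 * X ^ 20 + 3 * X ^ 26 - 6 * X ^ 29 - 3 * X ^ 32 - 2 * X ^ 35 - 3 * X ^ 38 + 3 * X ^ 41 + 3 * X ^ 47 + X ^ 53 : ℂ[X]) (by ring) (QRemainder.pow h60 3)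
  have h62 := QRemainder.reduce (1 + X + 2 * X ^ 2 + 2 * X ^ 4 + X ^ 5 + 2 * X ^ 6 + X ^ 8 + 2 * X ^ 9) (-40 - 56 * X - 75 * X ^ 2 + 25 * X ^ 3 + 35 * X ^ 4 + 55 * X ^ 5 + 75 * X ^ 6 + 110 * X ^ 7 + 150 * X ^ 8 : ℂ[X]) (by ring) (QRemainder.mul h59 h61)
  have h63 := EulerRemaindersTwenty.tendsto_mono (show 9 ≤ 33 by norm_num) LevelFortyFive.tendsto_eulerFn_five_thirtyThree
  have h64 := QRemainder.inv (1 + X ^ 5) (-2 - X ^ 5 + X ^ 15 + X ^ 20 : ℂ[X]) (by ring)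
    (fun τ ↦ eulerFn_ne_zero (by norm_num) τ) (by simp) h63
  have h65 := QRemainder.reduce (1 + X + 2 * X ^ 2 + 2 * X ^ 4 + 2 * X ^ 5 + 3 * X ^ 6 + 2 * X ^ 7 + X ^ 8 + 4 * X ^ 9) (1 + 2 * X + X ^ 3 + 2 * X ^ 4 : ℂ[X]) (by ring) (QRemainder.mul h62 h64)
  have h66 := tendsto_eulerFn (δ := 15) (m := 9) (by norm_num)
  have h67 := QRemainder.pow h66 3
  have h68 := QRemainder.mul h65 h67
  have h69 := QRemainder.reduce (X ^ 2 + X ^ 3 + 2 * X ^ 4 + 2 * X ^ 6 + 2 * X ^ 7 + 3 * X ^ 8 + 2 * X ^ 9) (1 + 4 * X : ℂ[X]) (by ring) (QRemainder.qParam_pow_mul 2 h68)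
  have h70 := QRemainder.reduce (2 * X ^ 2 + 2 * X ^ 3 + 4 * X ^ 4 + 4 * X ^ 6 + 4 * X ^ 7 + 6 * X ^ 8 + 4 * X ^ 9) (0 : ℂ[X]) (by simp only [map_ofNat]; ring) (QRemainder.const_mul (2 : ℂ) h69)
  have h71 := QRemainder.add h57 h70
  have hfin := QRemainder.congr_poly (P' := (X + 4 * X ^ 2 + 7 * X ^ 4 + 5 * X ^ 5 - 3 * X ^ 6 + 8 * X ^ 7 + 12 * X ^ 8 - 3 * X ^ 9 : ℂ[X])) (by ring) h71
  exact QRemainder.congr_fun (fun τ ↦ by ring) hfin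

set_option maxHeartbeats 800000 in -- staged `QRemainder` products at precision 9
/-- **`2E₃²E₁₅² − 3qE₁E₅E₉E₄₅`** (`= q³(E₉E₄₅)²·(2S − 3T)`) `= 2 - 3 * q + 3 * q ^ 2 - q ^ 3 - 2 * q ^ 6 - 3 * q ^ 7 - 6 * q ^ 8 + 4 * q ^ 9 + o(q⁹)`. [folklore] -/
theorem tendsto_Y :
    Tendsto (fun τ : ℍ ↦ ((2 * (eulerFn 3 τ ^ 2 * eulerFn 15 τ ^ 2) - 3 * (Function.Periodic.qParam 1 (τ : ℂ) ^ 1 * (eulerFn 1 τ * eulerFn 5 τ * eulerFn 9 τ * eulerFn 45 τ)))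
      - (2 - 3 * X + 3 * X ^ 2 - X ^ 3 - 2 * X ^ 6 - 3 * X ^ 7 - 6 * X ^ 8 + 4 * X ^ 9 : ℂ[X]).eval (Function.Periodic.qParam 1 (τ : ℂ)))
      / Function.Periodic.qParam 1 (τ : ℂ) ^ 9) atImInfty (𝓝 0) := by
  have h1 := EulerRemaindersTwenty.tendsto_mono (show 9 ≤ 33 by norm_num) LevelFortyFive.tendsto_eulerFn_three_thirtyThree
  have h2 := QRemainder.reduce (1 - 2 * X ^ 3 - X ^ 6 + 2 * X ^ 9) (X ^ 2 + 2 * X ^ 5 - 2 * X ^ 8 - 2 * X ^ 14 - 2 * X ^ 17 + X ^ 20 + 2 * X ^ 26 + X ^ 32 : ℂ[X]) (by ring) (QRemainder.pow h1 2)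
  have h3 := tendsto_eulerFn (δ := 15) (m := 9) (by norm_num)
  have h4 := QRemainder.pow h3 2
  have h5 := QRemainder.mul h2 h4
  have h6 := QRemainder.reduce (2 - 4 * X ^ 3 - 2 * X ^ 6 + 4 * X ^ 9) (0 : ℂ[X]) (by simp only [map_ofNat]; ring) (QRemainder.const_mul (2 : ℂ) h5)
  have h7 := EulerRemaindersTwenty.tendsto_mono (show 9 ≤ 33 by norm_num) LevelFortyFour.tendsto_eulerFn_one_thirtyThree
  have h8 := EulerRemaindersTwenty.tendsto_mono (show 9 ≤ 33 by norm_num) LevelFortyFive.tendsto_eulerFn_five_thirtyThree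
  have h9 := EulerRemaindersTwenty.tendsto_mono (show 9 ≤ 33 by norm_num) LevelFortyFive.tendsto_eulerFn_nine_thirtyThree
  have h10 := tendsto_eulerFn (δ := 45) (m := 9) (by norm_num)
  have h11 := QRemainder.reduce (1 - X - X ^ 2 + X ^ 6 + 2 * X ^ 7) (-2 + X - X ^ 2 - 2 * X ^ 5 + X ^ 10 + 2 * X ^ 12 + 2 * X ^ 15 - 2 * X ^ 17 + X ^ 20 - X ^ 21 - X ^ 26 - X ^ 27 - X ^ 30 + X ^ 37 + X ^ 41 : ℂ[X]) (by ring) (QRemainder.mul h7 h8)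
  have h12 := QRemainder.reduce (1 - X - X ^ 2 + X ^ 6 + 2 * X ^ 7 - X ^ 9) (1 + X - X ^ 5 - 2 * X ^ 6 - X ^ 8 + X ^ 9 + X ^ 10 - X ^ 14 - 2 * X ^ 15 : ℂ[X]) (by ring) (QRemainder.mul h11 h9)
  have h13 := QRemainder.mul h12 h10
  have h14 := QRemainder.reduce (X - X ^ 2 - X ^ 3 + X ^ 7 + 2 * X ^ 8) (-1 : ℂ[X]) (by ring) (QRemainder.qParam_pow_mul 1 h13)
  have h15 := QRemainder.reduce (3 * X - 3 * X ^ 2 - 3 * X ^ 3 + 3 * X ^ 7 + 6 * X ^ 8) (0 : ℂ[X]) (by simp only [map_ofNat]; ring) (QRemainder.const_mul (3 : ℂ) h14)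
  have h16 := QRemainder.sub h6 h15
  have hfin := QRemainder.congr_poly (P' := (2 - 3 * X + 3 * X ^ 2 - X ^ 3 - 2 * X ^ 6 - 3 * X ^ 7 - 6 * X ^ 8 + 4 * X ^ 9 : ℂ[X])) (by ring) h16
  exact QRemainder.congr_fun (fun τ ↦ by ring) hfin

set_option maxHeartbeats 800000 in -- staged `QRemainder` products at precision 9
/-- **`φ₄₅·(2E₃²E₁₅² − 3qE₁E₅E₉E₄₅)`** `= 2 * q - q ^ 2 - 4 * q ^ 7 - 10 * q ^ 8 + o(q⁹)`. [folklore] -/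
theorem tendsto_termB :
    Tendsto (fun τ : ℍ ↦ ((((3 * (Function.Periodic.qParam 1 (τ : ℂ) ^ 6 * ((eulerFn 3 τ)⁻¹ * eulerFn 9 τ ^ 3 * (eulerFn 15 τ)⁻¹ * eulerFn 45 τ ^ 3)) - 3 * (Function.Periodic.qParam 1 (τ : ℂ) ^ 10 * ((eulerFn 15 τ ^ 2)⁻¹ * eulerFn 45 τ ^ 6)) - 3 * (Function.Periodic.qParam 1 (τ : ℂ) ^ 2 * ((eulerFn 3 τ ^ 2)⁻¹ * eulerFn 9 τ ^ 6)) - 8 * (Function.Periodic.qParam 1 (τ : ℂ) ^ 4 * ((eulerFn 3 τ)⁻¹ * eulerFn 9 τ * eulerFn 15 τ ^ 3 * eulerFn 45 τ))) + ((((eulerFn 5 τ ^ 3)⁻¹ * eulerFn 15 τ ^ 10 * (eulerFn 45 τ ^ 3)⁻¹)) - 2 * (((eulerFn 3 τ ^ 2)⁻¹ * eulerFn 9 τ ^ 4 * eulerFn 15 τ ^ 4 * (eulerFn 45 τ ^ 2)⁻¹)) - (Function.Periodic.qParam 1 (τ : ℂ) ^ 4 * ((eulerFn 1 τ)⁻¹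 * eulerFn 3 τ ^ 2 * eulerFn 5 τ ^ 2 * (eulerFn 9 τ)⁻¹ * eulerFn 45 τ ^ 2)) + (((eulerFn 1 τ)⁻¹ * eulerFn 3 τ * eulerFn 5 τ ^ 2 * eulerFn 9 τ ^ 2 * eulerFn 15 τ * (eulerFn 45 τ)⁻¹)) + 2 * (Function.Periodic.qParam 1 (τ : ℂ) ^ 2 * ((eulerFn 1 τ)⁻¹ * eulerFn 3 τ ^ 3 * (eulerFn 5 τ)⁻¹ * eulerFn 15 τ ^ 3)))) * (2 * (eulerFn 3 τ ^ 2 * eulerFn 15 τ ^ 2) - 3 * (Function.Periodic.qParam 1 (τ : ℂ) ^ 1 * (eulerFn 1 τ * eulerFn 5 τ * eulerFn 9 τ * eulerFn 45 τ))))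
      - (2 * X - X ^ 2 - 4 * X ^ 7 - 10 * X ^ 8 : ℂ[X]).eval (Function.Periodic.qParam 1 (τ : ℂ)))
      / Function.Periodic.qParam 1 (τ : ℂ) ^ 9) atImInfty (𝓝 0) := by
  have h1 := tendsto_phiA
  have h2 := tendsto_phiB
  have h3 := QRemainder.add h1 h2
  have h4 := tendsto_Y
  have h5 := QRemainder.reduce (2 * X - X ^ 2 - 4 * X ^ 7 - 10 * X ^ 8) (-9 + 12 * X + 9 * X ^ 2 + 2 * X ^ 3 + 2 * X ^ 4 + 9 * X ^ 5 + 18 * X ^ 6 - 12 * X ^ 7 : ℂ[X]) (by ring) (QRemainder.mul h3 h4)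
  have hfin := QRemainder.congr_poly (P' := (2 * X - X ^ 2 - 4 * X ^ 7 - 10 * X ^ 8 : ℂ[X])) (by ring) h5
  exact QRemainder.congr_fun (fun τ ↦ by ring) hfin

/-! ## §2 (I2a)₄₅ as a `q`-limit -/

/-- **(I2a)₄₅ as a limit**: `((2πi)⁻¹T′ + φ₄₅·(2S − 3T))/q⁶ → 0` at `i∞` for `φ₄₅ = −3B1 + 3B2 − 3B3 − 8B4 − 2B5 + B7 − B8 + B9 + 2B10`.
[cite: Ligozat1975, Ch. 4] -/
theorem tendsto_I2a :
    Tendsto (fun τ : ℍ ↦ ((2 * π * I)⁻¹ * deriv (etaQuotient 45 (expFn [(1, 1), (5, 1), (9, -1), (45, -1)]) ∘ ofComplex) τ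
      + (-3 * B1 τ + 3 * B2 τ - 3 * B3 τ - 8 * B4 τ - 2 * B5 τ + B7 τ - B8 τ + B9 τ + 2 * B10 τ) * (2 * etaQuotient 45 (expFn [(3, 2), (9, -2), (15, 2), (45, -2)]) τ - 3 * etaQuotient 45 (expFn [(1, 1), (5, 1), (9, -1), (45, -1)]) τ))
      / Function.Periodic.qParam 1 (τ : ℂ) ^ 6) atImInfty (𝓝 0) := by
  have h2pi : (2 * π * I : ℂ) ≠ 0 := by simp [Real.pi_ne_zero, I_ne_zero]

  have h1 := tendsto_termA
  have h2 := tendsto_termB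
  have h3 := QRemainder.add h1 h2
  have hfin := QRemainder.congr_poly (P' := (0 : ℂ[X])) (by ring) h3
  have hlim := (QRemainder.tendsto_div_pow 9 le_rfl hfin).mul
    ((((isIntUnitQExp_eulerFn (by norm_num : 0 < 9)).tendsto_one.mul
      (isIntUnitQExp_eulerFn (by norm_num : 0 < 45)).tendsto_one).pow 2).inv₀ (by norm_num))
  rw [zero_mul] at hlim
  have hmain : Tendsto (fun τ : ℍ ↦ ((2 * π * I)⁻¹ * deriv (etaQuotient 45 (expFn [(1, 1), (5, 1), (9, -1), (45, -1)]) ∘ ofComplex) τ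
      + (-3 * B1 τ + 3 * B2 τ - 3 * B3 τ - 8 * B4 τ - 2 * B5 τ + B7 τ - B8 τ + B9 τ + 2 * B10 τ) * (2 * etaQuotient 45 (expFn [(3, 2), (9, -2), (15, 2), (45, -2)]) τ - 3 * etaQuotient 45 (expFn [(1, 1), (5, 1), (9, -1), (45, -1)]) τ)) / Function.Periodic.qParam 1 (τ : ℂ) ^ 9 * Function.Periodic.qParam 1 (τ : ℂ) ^ 3) atImInfty (𝓝 0) := by
    refine hlim.congr fun τ ↦ ?_
    have hE1 := eulerFn_ne_zero (by norm_num : 0 < 1) τ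
    have hE3 := eulerFn_ne_zero (by norm_num : 0 < 3) τ
    have hE5 := eulerFn_ne_zero (by norm_num : 0 < 5) τ
    have hE9 := eulerFn_ne_zero (by norm_num : 0 < 9) τ
    have hE15 := eulerFn_ne_zero (by norm_num : 0 < 15) τ
    have hE45 := eulerFn_ne_zero (by norm_num : 0 < 45) τ
    have hq := qParam_ne_zero τ
    rw [deriv_T45, T45_eq, S45_eq, B1_apply, B2_apply, B3_apply, B4_apply, B5_apply, B7_apply, B8_apply, B9_apply, B10_apply]
    field_simp
    ring
  have hq3 : Tendsto (fun τ : ℍ ↦ (Function.Periodic.qParam 1 (τ : ℂ) ^ 3)⁻¹ * Function.Periodic.qParam 1 (τ : ℂ) ^ 3) atImInfty (𝓝 1) :=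
    tendsto_const_nhds.congr fun τ ↦ by rw [inv_mul_cancel₀ (pow_ne_zero 3 (qParam_ne_zero τ))]
  refine (hmain.congr fun τ ↦ ?_)
  rw [div_mul_eq_mul_div, show Function.Periodic.qParam 1 (τ : ℂ) ^ 9 = Function.Periodic.qParam 1 (τ : ℂ) ^ 6 * Function.Periodic.qParam 1 (τ : ℂ) ^ 3 by ring,
    mul_div_mul_right _ _ (pow_ne_zero 3 (qParam_ne_zero τ))]

end Summit.BirchSwinnertonDyer.BirchSwinnertonDyer.Theorems.ManinLocalTwoThree.EtaLimitDerivFortyFive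

end
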